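import Summits.BirchSwinnertonDyer.BirchSwinnertonDyer.Theorems.ByReductionTypeAtTwoRankOneAtTwoOneDoorLawCDefs
import Summits.BirchSwinnertonDyer.BirchSwinnertonDyer.Theorems.ByReductionTypeAtTwoRankOneAtTwoBigImageOddLocalOneDoorParity
import Literature.NumberTheory.EllipticCurves.KrizLi2019.TwoPartBSDTwists
import Literature.NumberTheory.EllipticCurves.Selmer
import HarnessLib

/-!
# Cell `bsd-f1-sign2`, lens `-an` g14 (MEMO-an v1.24 §2 AN-31): THE BOTTOM LAYER OF THE ONE-DOOR LAW AT `2` IS A LOCAL BIT AT `2`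
# (the `2`-adic logarithm of the Heegner point — Kriz–Li's `(★)` — read as the `m = 0` layer of `stub_doorLowerC`) — rows AN-31a
# `TwoDivisibilityLogBoundAtTwo` (THEOREM-candidate), AN-31a′ `StarCapsExponentAtTwo`, AN-31b `LowerHalfOnStarLocusAtTwo`, AN-31
# `ExponentCapOfMinimalSelmerAtTwo` (`@[conjecture]`), AN-31↓ `LowerHalfOnMinimalSelmerLocusAtTwo`, AN-31c `MinimalSelmerOfOddIndexAtTwo`
# (`@[conjecture]`), AN-31M `SilentTwistStarRigidityAtTwo`, AN-31P `PrimitivityPropagatesAtTwo` (plain defs, theorem-candidates), 8 glue lemmas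

Currency.  The cell's crux `RankOneAtTwoBigImageOddLocal` is now the two halves `DoorIndexLawUpperCAtTwo` (Kolyvagin side) and
`DoorIndexLawLowerCAtTwo` (exactness side) of the one-door law (tree, p626076), for the exact `2`-divisibility exponent `m` of a
Heegner point `P ∈ E(K)` modulo torsion at a door `K = ℚ(√d)`:  `2m + [Δ<0] = s_E + s_d + t + 2s + 2·ord₂ c`.
This sketch isolates the BOTTOM LAYER `m ≤ ord₂ c` of the `≤` half and the one analytic quantity that decides it in print:

  `L(W, j, P) := log_Ŵ((c₂·n₂) • P_j) ∈ ℚ₂`  (`j : K → ℚ₂` one of the two embeddings at the split prime `2`, `c₂` the local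
  Tamagawa number at `2`, `n₂ = #Ẽ_ns(𝔽₂)`; Kriz–Li's normalisation, tree `KrizLi2019.AssumptionStar`).

* AN-31a (THEOREM-CANDIDATE, formal group only): `P ∈ 2^m E(K) + tors ⟹ ‖L(W,j,P)‖ ≤ 2^{-(m+1)}` — every `2`-division of the
  Heegner point costs one `2`-adic digit of its logarithm (`log_Ŵ(Ê(2ℤ₂)) ⊆ 2ℤ₂`, `log` kills torsion).
* AN-31a′ (THEOREM-CANDIDATE = Kriz–Li 2019 Lemma 4.1 in exponent currency): under `(★)` (`‖L/(c₂ c)‖ = 1/2`) and `c₂` odd,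
  `m ≤ ord₂ c` for EVERY exponent `m` of `P` — the bottom layer of `LOWER` is a theorem on the `(★)` locus.
* AN-31b (kernel glue, PROVED below from AN-31a′ + the tree's parity lemma `t ≡ [Δ<0] (2)`): the tree's `DoorIndexLawLowerCAtTwo`
  restricted to data satisfying `(★) ∧ c₂ odd` — a BC5 rung / first prover target for `stub_doorLowerC`.
* AN-31 (CONJECTURE = the bottom layer of `LOWER` in Selmer currency): `#Sel₂(E/K) = 2 ⟹ m ≤ ord₂ c`; implies the tree `LOWER` on
  that locus by the same glue (PROVED below); open in print OFF the `(★)` locus — in particular for every curve with `a₂` odd or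
  multiplicative reduction at `2` (then `Ê(ℤ₂)` has `2`-torsion or `E(ℚ₂)[2] ≠ 0`, `ord₂ L ≥ m + 2`, and `(★)` never holds: Kriz–Li
  Ex. 6.2), which is where `stub_doorLowerC` has no printed input at all ("KL-silent rows" of ENGINE S).
* AN-31c (CONJECTURE = the bottom layer of `UPPER` in Selmer currency; Kriz–Li Cor. 4.2's "prediction … not known in general how to
  show this directly"): `ord₂ c = 0 ∧ m = 0 ⟹ #Sel₂(E/K) = 2` — Kolyvagin's first layer at `p = 2`.
* AN-31M (THEOREM-CANDIDATE = Kriz–Li Thm. 1.16/3.3 read two-sidedly): the tree's `(★)`-bit `AssumptionStar` is an INVARIANT of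
  Kriz–Li's silent quadratic-twist orbit `W ↦ W^{(ℓ*)}` (`ℓ ∤ 2N` split in `K`, `a_ℓ` odd) over a fixed door `K`, at data of odd constant.
* AN-31P (THEOREM-CANDIDATE, elementary: `Λ = 1` is the local bit at `2` of the Selmer line `Sel₂(E/K) = 𝔽₂·κ(R)`, and Kriz–Li L4.6 makes
  that line orbit-constant; found as a BSD₂(E/K)-consequence: `ord₂(normLog) = m + Λ`, AN-31 ∧ AN-31M ⟹ AN-31P): on `{#Sel₂(E/K) = 2, a = 0}` the
  `2`-adic primitivity of the Mordell–Weil generator PROPAGATES along the silent orbit (ENGINE T, P31.8, Heegner-free census).  Consequence: the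
  bottom bit of the Heegner index is orbit-constant on `{σ = 1, a = 0, Λ = 1}` (Kriz–Li's reach) and the locus `{σ = 1, a = 0, Λ ≥ 2}` (21% of
  `a = 0` curves) is orbit-closed and invisible to `(★)` — the exact bottom-layer frontier of `stub_doorLowerC` inside `a = 0`.
Census (kit tag `bsd-frontier-data`; `MEMO-an-data/g14/SHA16SUMS.txt`) = ENGINE S j307611 (`g14/jobS/`: 1 712 slice curves `N ≤ 39 960`, 1 576
AJ-certified Heegner indices; law control 1 541/1 541 incl. `(2,2)` ×279, `(4,4)` ×23; **1 239/1 239 clean rows `m = 0`** for AN-31 and AN-31c)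
+ ENGINE T j308002 (`g14/jobT/`, Heegner-free: 2 238 silent pairs from Cremona generators, `N′ ≤ 495 725`; P31.8 567/567 `σ = 1` pairs in
`K`-currency, β-bit 1 747/1 747, 0 violations) + ENGINE B j308331 (`g14/jobB/`, PARI halving bit: `a = 0 ⟹ (β = 1 ⟺ Λ = 1)` 591/591; R31.1:
Sage `division_points` over `ℚ₂` gave 6/1 712 false negatives — not used for β).  Nothing is asserted: `def … : Prop` only, plus kernel-checked glue.
[cite: KrizLi2019, Lemma 4.1, Cor. 4.2, Thm. 3.3, Lemma 4.4, Lemma 4.6, Ex. 6.2, Rem. 6.6]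

TYPER FILING (cell `bsd-f1-sign2`, seat `-ty` g9; CANDIDATES.md rows AN-31a/a′/b/31/31↓/31c/31M/31P; -an g14 CANDIDATES-delta 2026-08-28T12:27:42Z,
filing ask D-an-58 «ONE module `Rank1Residual/F1Sign2/BottomLayerAtTwo.lean` = the `ANg14.BottomLayer` namespace block of Sketch_v22 verbatim,
statement-only + the 8 proved glue lemmas, AFTER REF1 D-an-56»): the namespace block of `HOME/MEMO-an-data/g14/Sketch_v22.lean` 15bff874feb57425 (-an: farm
rc 0, 0 sorry; BC7 8/8 CLEAN `g14/bc/Probe_v22.lean` 0850f2994632faf3 → `Probe_v22.txt` 5f01ede1cddaab52) VERBATIM under the cell namespace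
`…Rank1Residual.F1Sign2.BottomLayer` (same four imports; helper defs `normLogAtTwo`, `tamagawaAtTwo`, `TwoAdicallyPrimitiveAt`, `signedPrime`;
glue `norm_intCast_eq_two_zpow`, `exponent_le_of_norms`, `starCaps_of_logBound`, `signIndicator_le_transpCount`, `lowerOnStar_of_starCaps`,
`lowerOnStar_of_logBound`, `lowerOnMinSel_of_cap`, `bottomBit_transport` PROVED, axioms standard) with ONE statement deviation — the REF1 §107 r9
binder `(∃ R, R ∉ E(K)_tors) →` in AN-31P (see its docstring); other typer edits = this header, the REF1/REF2 sentences, riders r3/r4 (cite tag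
`MazurRubin2010, Lemma 2.10 / Cor. 3.4` resolved) and the PROVED note on AN-31a (sibling `F1Sign2/BottomLayerAtTwoProofs.lean`).  Kriz–Li numbers in
this file are the arXiv:1606.03172 numbers (Lemma 4.1, Cor. 4.2, Thm. 3.3, Lemma 4.4, Lemma 4.6, Ex. 6.2, Rem. 6.6, Thm. 1.8 (= FMS Thm. 1.16)), as in the sketch (REF2 v29 §2.2 numbering table FMS ⟷ arXiv); the
Literature file `KrizLi2019/TwoPartBSDTwists.lean` puts the FMS numbers first (FMS Thm 4.3 = arXiv Thm 3.3) — REF1 §107 r4.  Builder `tools/mk_an31.py`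
(`HOME/MEMO-ty-data/g9/`).
REF1-AUDIT §107 (refuter-bsd-f1-sign2-ref1 g10, 2026-08-28T12:56:18Z; evidence `HOME/REF1-data/b107/`, Probe107.lean cc107e8d1bf80cbd farm rc 0, 17/17 glue+e-lemmas trio; recount107.py 5bfa01b421f30ce4): AN-31 rows of Sketch_v22 15bff874feb57425 (= the -ty draft 15ceadf13f0af8a0, 20/20 decls identical) — `ExponentCapOfMinimalSelmerAtTwo` (AN-31) and `MinimalSelmerOfOddIndexAtTwo` (AN-31c) SURVIVE as typed, conjecture-grade (the two halves of BSD₂(E/K) at the bottom layer via Gross's index identity; open at 2 in print, KL arXiv:1606.03172 p0016); `TwoDivisibilityLogBoundAtTwo` (AN-31a) and `SilentTwistStarRigidityAtTwo` (AN-31M) SURVIVE as theorem-candidates (formal group at 2; KL Thm 1.8 read mod 2); `PrimitivityPropagatesAtTwo` (AN-31P) SURVIVES (KL Lemma 4.6's Selmer-line identity + the a = 0 pro-cyclicity of E(ℚ₂) ⊗ ℤ₂) and is a theorem-candidate once the rank-0 / infinite-Ш corner is closed by ONE binder — recommended `(∃ R : (W.baseChange K).toAffine.Point, R ∉ AddCommGroup.torsion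 _) →` after the Selmer binder (rider r9 — ADOPTED in this filing; census untouched); `StarCapsExponentAtTwo`, `LowerHalfOnStarLocusAtTwo`, `LowerHalfOnMinimalSelmerLocusAtTwo` SURVIVE with their kernel glue (8/8 theorems ⊆ {propext, Classical.choice, Quot.sound}); REF1 kernel lemmas e1–e7 (LOWER ⟹ AN-31b and ⟹ AN-31↓ by restriction; silent-prime binders = `KrizLi2019.InS` by `Iff.rfl`; `signedPrime ℓ ≡ 1 (4)`; torsion points have no exact exponent, so `TwoAdicallyPrimitiveAt` is vacuous exactly there; AN-31 at odd constant reads `σ(E/K) = 1 ⟹ m = 0`; doors are ≡ 1 (8); the r9 variant elaborates and is implied by the row as typed); elaboration rc 0; independent recount of ENGINES S/T/B from the raw rows: certified 1 576, P31.1 1 239/1 239, P31.2 1 239/1 239, law 1 541/1 541, (★)-rows 332 (a = 0, c₂ odd, clean on all), KL-silent clean 907 (576 with N > 5 000), a = 0: Λ = 1 on 465/591, β_B ⟺ Λ on 591/591, P31.8 567/567 + 47/47 extra-room, β-bit orbit-constant 1 745/1 745, 0 violations; KILLED none; riders r1–r9 text-only except r9 (r3: the σ(E/K) column is the ℚ-proxy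 at the minimal door — a direct K-descent sample is the upgrade; r4: cite tags resolved).  PARTITION none; beyond-print theorem no; BSD not proved.
REF2-PLACEMENT v29 §2 (refuter-bsd-f1-sign2-ref2 g29, 2026-08-28T13:16:41Z; `HOME/REF2-PLACEMENT-v29.md` bb34ccc23b16f7e7): -an's placement CONFIRMED from print and sharpened — AN-31a KNOWN (formal group; the displayed step «c₂(E)·|Ẽ^{ns}(𝔽₂)|·Q ∈ Ê(2𝒪_{K_2}) ⟹ |Ẽ^{ns}(𝔽₂)|·log_E Q ∈ 2𝒪_{K_2}» of the proof of Kriz–Li Lemma 4.1 (= FMS Lemma 5.4), for `2^m` instead of `2`; AEC IV.6.3); AN-31a′ KNOWN = Kriz–Li Lemma 4.1 contraposed, in exponent currency (Kriz–Li derive `c_E` odd from Abbes–Ullmo at good/multiplicative `2` and assume it at additive `2`; here `ord₂ c` is a parameter); AN-31b, AN-31↓ in-print assembly; AN-31M KNOWN = the instance `(p, m, E′, M, pNN′/M) = (2, 1, E^{(ℓ*)}, N², 2ℓ²)` of Kriz–Li Thm. 1.8 (= FMS Thm. 1.16), an equation mod `2𝒪_{K_2}` with unit Euler factors (Rem. 1.9),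 hence symmetric — the two-sided reading is not beyond print; AN-31P in-print assembly (proof of Kriz–Li Lemma 4.6 (= FMS 5.9) uses of «BSD(2) for E/K» only «c_ℓ(E) odd for ℓ ∣ N», which the slice supplies, with Mazur–Rubin 2010 Lemma 2.10 (ii),(v) / Cor. 3.4 (ii); `Λ = 1 ⟺ loc₂κ(R) ≠ 0` at `a = 0` is formal-group folklore); AN-31 and AN-31c: NOT IN PRINT, not refuted in print, OPEN at `p = 2`, conjecture-grade, BSD₂(E/K)-implied (full text in the AN-31 docstring below). Grade of the typed layer: NEW-COMBINATION; beyond-print theorem: no; PARTITION none; BSD not proved. Cite-string riders §2.6 (a)–(f) folded in this file (arXiv numbering kept pure, FMS numbers in parentheses).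
PARTITION: none moved (frontier tier); beyond-print theorem: no; BSD is not proved by any of this.
bears_on: crux stmt-BirchSwinnertonDyer-23715 (line `one_door_analytic` v8.6; the L child `stub_doorLowerC` of the SPLIT: AN-31b = BC5 witness / first
`--supports` rung, D-an-57), crux idea `bottom-layer-local-bit` (evidence #50); asks D-an-56 (REF1), D-an-59 (-data), D-an-60 (-es, -imc).
-/

set_option autoImplicit false

noncomputable section

open scoped Classical

namespace Summit.BirchSwinnertonDyer.Rank1Residual.F1Sign2.BottomLayer

open Literature.NumberTheory.EllipticCurves Literature.NumberTheory.EllipticCurves.ModularForms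
  Literature.NumberTheory.EllipticCurves.KrizLi2019
  Summit.BirchSwinnertonDyer.BirchSwinnertonDyer.Theorems.RankOneAtTwoOneDoor

/-! ### §0 The quantity -/

/-- **Kriz–Li's normalised `2`-adic logarithm of a `K`-point at an embedding `j : K → ℚ₂`**:
`L(W, j, P) := log_Ŵ((c₂ · n₂) • P_j)`, with `c₂ = c₂(W/ℚ₂)` the local Tamagawa number and `n₂ = #Ẽ_ns(𝔽₂)` (tree
`nsPointCountAtTwo`), so that `(c₂ n₂) • P_j ∈ Ê(2ℤ₂)` and the formal logarithm converges.  This is the numerator of the tree's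
`KrizLi2019.AssumptionStar`. [cite: KrizLi2019, (★) of Thm. 1.4 (= FMS Thm. 1.12); Lemma 4.1] -/
def normLogAtTwo (W : WeierstrassCurve ℚ) [W.IsGloballyMinimal] (K : Type) [Field K] [NumberField K]
    (j : K →ₐ[ℚ] ℚ_[2]) (P : (W.baseChange K).toAffine.Point) : ℚ_[2] :=
  haveI : Fact (Nat.Prime 2) := ⟨Nat.prime_two⟩
  (W.baseChange ℚ_[2]).padicLogPoint
    ((((W.baseChange ℚ_[2]).localTamagawaNumber ℤ_[2]) * nsPointCountAtTwo W) • WeierstrassCurve.Affine.Point.map j P)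

/-- The local Tamagawa number of `W` at `2`, `c₂ = [E(ℚ₂) : E₀(ℚ₂)]` (tree `localTamagawaNumber` of the base change to `ℚ₂`). -/
def tamagawaAtTwo (W : WeierstrassCurve ℚ) : ℕ :=
  haveI : Fact (Nat.Prime 2) := ⟨Nat.prime_two⟩
  (W.baseChange ℚ_[2]).localTamagawaNumber ℤ_[2]

/-! ### §1 AN-31a — the formal-group bound (THEOREM-CANDIDATE) -/

/-- **AN-31a `TwoDivisibilityLogBoundAtTwo` (THEOREM-CANDIDATE; formal group at `2` only).**  For `W/ℚ` globally minimal, `K` a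
number field with an embedding `j : K → ℚ₂`, and `P ∈ E(K)`: if `P ∈ 2^m E(K) + E(K)_tors` (any `Q` with `P − 2^m Q` torsion) then
`‖L(W, j, P)‖₂ ≤ 2^{-(m+1)}`, i.e. `ord₂ log_Ŵ((c₂n₂)P_j) ≥ m + 1`.  Proof on paper: `(c₂n₂)Q_j ∈ Ê(2ℤ₂)`, `log_Ŵ` is a homomorphism
on `Ê(2ℤ₂)` (tree fact `padicLogPoint_add`) killing torsion, and `log_Ŵ(2ℤ₂) ⊆ 2ℤ₂` (`ord₂(b_n z^n / n) ≥ n − ord₂ n ≥ 1`).  No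
hypothesis on `c₂`, the reduction type, `Ш` or Selmer groups.  Why it might fail: only through the junk value of `padicLogPoint` off
`Ê(2ℤ₂)` — excluded since `c₂ n₂` kills `E(ℚ₂)/E₁(ℚ₂)` for the minimal model.
PROVED (seat -ty g9, kernel, axioms {propext, Classical.choice, Quot.sound}): `twoDivisibilityLogBoundAtTwo_holds` in the sibling THEOREMS-ONLY
module `F1Sign2/BottomLayerAtTwoProofs.lean` (filed with this file) — `c₂·n₂ = [E(ℚ₂):E₁(ℚ₂)]` EXACTLY (`index_formalFiltration`, AEC VII.2.1, with
`nsPointCountAtTwo W = reductionPointCount W 2` in all four reduction types), so `(c₂n₂)·X ∈ E₁(ℚ₂)` for every `X` and the junk case never occurs;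
`log` additive and `ℤ`-linear on `E₁(ℚ₂)` (`padicLogPoint_add_holds`), zero on torsion, `log_Ŵ(E₁(ℚ₂)) ⊆ 2ℤ₂`; hence AN-31a′ and AN-31b below are
THEOREMS (`starCapsExponentAtTwo_holds`, `lowerHalfOnStarLocusAtTwo_holds`).  REF1 §107: SURVIVES as a theorem-candidate (r1/r2: the def has no
`Odd c₂` hypothesis and no `/c₂` — stronger than the memo prose, correct; r6 named the tree facts used).
[cite: SilvermanAEC2009, IV.6.3, IV.6.4 and VII.2.2] (REF2 v29 §2.6(c): the inclusion `log_Ê(Ê(2ℤ₂)) ⊆ 2ℤ₂` used is the estimate `ord₂(zⁿ/n) ≥ n − ord₂ n ≥ 1` of IV.6.3; IV.6.4's isomorphism holds on `Ê(4ℤ₂)` at `p = 2`) [cite: KrizLi2019, proof of Lemma 4.1] -/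
def TwoDivisibilityLogBoundAtTwo : Prop :=
  ∀ (W : WeierstrassCurve ℚ) [W.IsElliptic] [W.IsGloballyMinimal] (K : Type) [Field K] [NumberField K]
    (j : K →ₐ[ℚ] ℚ_[2]) (P Q : (W.baseChange K).toAffine.Point) (m : ℕ),
    P - (2 ^ m) • Q ∈ AddCommGroup.torsion (W.baseChange K).toAffine.Point →
      ‖normLogAtTwo W K j P‖ ≤ (2 : ℝ) ^ (-((m : ℤ) + 1))

/-! ### §2 AN-31a′ — Kriz–Li's Lemma 4.1 in exponent currency (THEOREM-CANDIDATE) and the `(★)`-locus rung of `LOWER` -/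

/-- **AN-31a′ `StarCapsExponentAtTwo` (THEOREM-CANDIDATE = Kriz–Li 2019 Lemma 4.1, exponent form).**  If `c₂(W)` is odd and the
parametrisation datum `Dt` (constant `c`) and the point `P ∈ E(K)` satisfy Kriz–Li's `(★)` at `j` (tree `AssumptionStar`:
`2` splits in `K` and `‖L(W,j,P)/(c₂ c)‖₂ = 1/2`), then EVERY `2`-divisibility exponent `m` of `P` modulo torsion satisfies
`m ≤ ord₂ c` (for the optimal curve with odd Manin constant: `P ∉ 2E(K) + tors`).  ⟸ AN-31a by `‖c₂‖₂ = 1`, `‖c‖₂ = 2^{-ord₂ c}`.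
Why it might fail: it does not as stated (norm arithmetic); the content is that `(★)` is a hypothesis on the DATUM, so a datum with
`2 ∣ c` is allowed and correctly accounted. [cite: KrizLi2019, Lemma 4.1] -/
def StarCapsExponentAtTwo : Prop :=
  ∀ (W : WeierstrassCurve ℚ) [W.IsElliptic] [W.IsGloballyMinimal] [NeZero (W.conductorNorm ℤ)]
    (K : Type) [Field K] [NumberField K] (Dt : ModularParametrizationData W (W.conductorNorm ℤ))
    (P : (W.baseChange K).toAffine.Point) (j : K →ₐ[ℚ] ℚ_[2]),
    Odd (tamagawaAtTwo W) → AssumptionStar W Dt K P j →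
      ∀ m : ℕ, HasTwoDivisibilityUpToTorsion W K P m → m ≤ padicValInt 2 Dt.c

/-- `‖(c : ℚ₂)‖ = 2^{-ord₂ c}` for a nonzero integer `c`. -/
theorem norm_intCast_eq_two_zpow (c : ℤ) (hc : c ≠ 0) :
    ‖(c : ℚ_[2])‖ = (2 : ℝ) ^ (-(padicValInt 2 c : ℤ)) := by
  have h1 : ‖(c : ℚ_[2])‖ = ‖((c : ℚ) : ℚ_[2])‖ := by norm_cast
  rw [h1, Padic.eq_padicNorm, padicNorm.eq_zpow_of_nonzero (by exact_mod_cast hc), padicValRat.of_int]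
  push_cast
  rfl

/-- The norm arithmetic of Kriz–Li's Lemma 4.1: `‖L/(ab)‖ = 1/2`, `‖a‖ = 1`, `‖b‖ = 2^{-v}`, `‖L‖ ≤ 2^{-(m+1)}` force `m ≤ v`. -/
theorem exponent_le_of_norms (L a b : ℚ_[2]) (v m : ℕ) (h1 : ‖L / (a * b)‖ = 2⁻¹) (ha : ‖a‖ = 1)
    (hb : ‖b‖ = (2 : ℝ) ^ (-(v : ℤ))) (hL : ‖L‖ ≤ (2 : ℝ) ^ (-((m : ℤ) + 1))) : m ≤ v := by
  have hab : a * b ≠ 0 := by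
    intro h0; rw [h0, div_zero, norm_zero] at h1; norm_num at h1
  rw [norm_div, norm_mul, ha, hb, one_mul] at h1
  have hpos : (0 : ℝ) < (2 : ℝ) ^ (-(v : ℤ)) := by positivity
  rw [div_eq_iff hpos.ne'] at h1
  rw [h1] at hL
  have h3 : (2 : ℝ)⁻¹ * (2 : ℝ) ^ (-(v : ℤ)) = (2 : ℝ) ^ (-((v : ℤ) + 1)) := by
    rw [show (-((v : ℤ) + 1)) = (-(v : ℤ)) + (-1) by ring, zpow_add₀ (by norm_num : (2 : ℝ) ≠ 0), zpow_neg_one, mul_comm]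
  rw [h3] at hL
  have h4 := (zpow_le_zpow_iff_right₀ (by norm_num : (1 : ℝ) < 2)).mp hL
  omega

/-- **Glue (PROVED): AN-31a ⟹ AN-31a′** — Kriz–Li's Lemma 4.1 reduced to the formal-group bound: `(★)` pins
`ord₂ L = 1 + ord₂ c` (as `c₂` is odd), and AN-31a gives `ord₂ L ≥ m + 1`. -/
theorem starCaps_of_logBound (h : TwoDivisibilityLogBoundAtTwo) : StarCapsExponentAtTwo := by
  intro W _ _ _ K _ _ Dt P j hodd hstar m hm
  obtain ⟨Q, hQ, _⟩ := hm
  have hL := h W K j P Q m hQ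
  obtain ⟨_, hs⟩ := hstar
  have hs' : ‖normLogAtTwo W K j P / (((tamagawaAtTwo W : ℕ) : ℚ_[2]) * (Dt.c : ℚ_[2]))‖ = 2⁻¹ := hs
  by_cases hc : Dt.c = 0
  · exfalso; rw [hc] at hs'; norm_num at hs'
  have ha : ‖((tamagawaAtTwo W : ℕ) : ℚ_[2])‖ = 1 := by
    rw [Padic.norm_natCast_eq_one_iff]; exact Nat.coprime_two_left.mpr hodd
  exact exponent_le_of_norms _ _ _ (padicValInt 2 Dt.c) m hs' ha (norm_intCast_eq_two_zpow Dt.c hc) hL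

/-- **AN-31b `LowerHalfOnStarLocusAtTwo`: the tree's `DoorIndexLawLowerCAtTwo` RESTRICTED to data satisfying `(★) ∧ c₂ odd`**
(binders of the tree decl verbatim, plus `j`, `Odd c₂`, `AssumptionStar W Dt K P j` after the Heegner-point binder).  PROVED below from
AN-31a′ and the tree's parity lemma `transpCount_mod_two_of_doorAdmissible` (`t ≡ [Δ<0] (2)` ⟹ `[Δ<0] ≤ t`): the first rung of
`stub_doorLowerC` that is a theorem in print.  It covers exactly the rows Kriz–Li's method reaches (`a₂` even or additive at `2`,
`E(ℚ₂)[2] = 0`, `2`-adically primitive generator, `m = 0`); ENGINE S column `star`. [cite: KrizLi2019, Lemma 4.1, Ex. 6.1–6.5] -/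
def LowerHalfOnStarLocusAtTwo : Prop :=
  ∀ (W : WeierstrassCurve ℚ) [W.IsElliptic] [W.IsGloballyMinimal] [NeZero (W.conductorNorm ℤ)],
    ¬ W.HasCM → (∀ n : ℕ, W.HasSurjectiveModNGaloisRep ((2 ^ n : ℕ) : ℤ)) → Odd W.torsionOrder → Odd W.tamagawaProduct →
    W.analyticRank = 1 →
    ∀ (K : Type) [Field K] [NumberField K], IsImaginaryQuadratic K →
      DoorAdmissible W (NumberField.discr K) →
      (W.quadraticTwist (NumberField.discr K : ℚ)).entireLFunction 1 ≠ 0 →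
      ∀ (Dt : ModularParametrizationData W (W.conductorNorm ℤ))
        (H : HeegnerDatum (W.conductorNorm ℤ) (NumberField.discr K)) (ι : K →+* ℂ)
        (P : (W.baseChange K).toAffine.Point),
        WeierstrassCurve.Affine.Point.map ι.toRatAlgHom P = heegnerPointComplex Dt H →
        ∀ (j : K →ₐ[ℚ] ℚ_[2]), Odd (tamagawaAtTwo W) → AssumptionStar W Dt K P j →
        ∀ (Wd : WeierstrassCurve ℚ) [Wd.IsElliptic] [Wd.IsGloballyMinimal] (Cd : WeierstrassCurve.VariableChange ℚ),
          Cd • W.quadraticTwist (NumberField.discr K : ℚ) = Wd →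
          ∀ m : ℕ, HasTwoDivisibilityUpToTorsion W K P m →
            2 * m + (if W.Δ < 0 then 1 else 0) ≤
              padicValNat 2 (Nat.card (AddCommGroup.primaryComponent W.sha 2)) +
                padicValNat 2 (Nat.card (AddCommGroup.primaryComponent Wd.sha 2)) +
                transpCount W (NumberField.discr K) + 2 * identCount W (NumberField.discr K) + 2 * padicValInt 2 Dt.c

/-- `[Δ_W < 0] ≤ t(W, d)` at a door: the sign indicator is bounded by the transposition count (from the tree's parity lemma). -/
theorem signIndicator_le_transpCount (W : WeierstrassCurve ℚ) [W.IsElliptic] [W.IsGloballyMinimal] {d : ℤ}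
    (hadm : DoorAdmissible W d) : (if W.Δ < 0 then 1 else 0) ≤ transpCount W d := by
  have h := transpCount_mod_two_of_doorAdmissible W hadm
  by_cases hΔ : W.Δ < 0
  · rw [if_pos hΔ] at h ⊢; omega
  · rw [if_neg hΔ]; exact Nat.zero_le _

/-- **Glue (PROVED): AN-31a′ ⟹ AN-31b** — on the `(★) ∧ c₂ odd` locus the `≤` half of the one-door law holds, by `2m ≤ 2 ord₂ c`
and `[Δ<0] ≤ t`. -/
theorem lowerOnStar_of_starCaps (h : StarCapsExponentAtTwo) : LowerHalfOnStarLocusAtTwo := by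
  intro W _ _ _ _hcm _hsurj _htor _htam _hr K _ _ _hK hadm _hL1 Dt H ι P _hP j hodd hstar Wd _ _ Cd _hCd m hm
  have hcap : m ≤ padicValInt 2 Dt.c := h W K Dt P j hodd hstar m hm
  have ht := signIndicator_le_transpCount W hadm
  omega

/-- **Glue (PROVED): AN-31a ⟹ AN-31b** — the `(★)`-locus rung of `stub_doorLowerC` from the formal-group bound alone. -/
theorem lowerOnStar_of_logBound (h : TwoDivisibilityLogBoundAtTwo) : LowerHalfOnStarLocusAtTwo :=
  lowerOnStar_of_starCaps (starCaps_of_logBound h)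

/-! ### §3 AN-31 / AN-31c — the bottom layer in Selmer currency (CONJECTURES) -/

/-- **AN-31 `ExponentCapOfMinimalSelmerAtTwo` (CONJECTURE; the bottom layer of `LOWER` in Selmer currency).**  On the slice, at a
door, for any datum `Dt` and Heegner point `P ∈ E(K)`: if `#Sel₂(E/K) = 2` (so `E(K) ⊗ ℤ₂ ≅ ℤ₂` and `Ш(E/K)[2] = 0`) then every
`2`-divisibility exponent of `P` satisfies `m ≤ ord₂ c`.  Under `BSD₂(E/K)` this is the Gross–Zagier index identity at the bottom
(`u_K = 1`, odd Tamagawa numbers, odd Manin constant ⟹ `ord₂[E(K):ℤP] = ord₂ c`).  PROVED in print exactly on the `(★)` sub-locus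
(AN-31a′, where the Selmer hypothesis is not even needed); OPEN in print off it — e.g. for every curve with `a₂` odd or multiplicative
at `2` (ENGINE S `klsilent`).  Why it might fail: a Heegner point divisible by `2` modulo torsion on a curve with `Sel₂(E/K)` of
order `2` contradicts `BSD₂(E/K)`; the statement is `Ш`-free and decidable row by row (PARI `ellrank` over `K` = `ellrank(E)` +
`ellrank(E^d)`, AJ matching for `m`; REF1 §107 r3: the census's «`#Sel₂(E/K) = 2`» column is this ℚ-PROXY at the minimal door — a direct
`2`-descent over `K = ℚ(√d)` on a sample is the proxy-free upgrade, D-an-59-adjacent).  Census ENGINE S P31.1 (kit j307611, tag `bsd-frontier-data`: 1 712 slice curves `N ≤ 39 960`, 1 576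
AJ-certified Heegner indices; 1 239/1 239 clean rows `m = 0`).
REF1 §107 (refuter-bsd-f1-sign2-ref1 g10, 12:56:18Z): SURVIVES as typed, conjecture-grade (= the `≤` half of «BSD₂(E/K) at the bottom» via Gross's index identity with `u_K = 1`, `c_ℓ` odd; open at `2` in print, KL arXiv:1606.03172 p0016), CLEARED; at odd constant it reads `σ(E/K) = 1 ⟹ m = 0` (e-lemma); BC7 independent recount: certified 1 576, P31.1 1 239/1 239, law 1 541/1 541, (★)-rows 332, KL-silent clean 907 (576 with `N > 5 000`), 0 violations.
REF2-PLACEMENT v29 §2.7 = REF2_TXT_AN31 (refuter-bsd-f1-sign2-ref2 g29, 2026-08-28T13:16:41Z; `HOME/REF2-PLACEMENT-v29.md` bb34ccc23b16f7e7; arXiv numbering as this file declares, FMS in parentheses): «-an's placement confirmed from print. AN-31a KNOWN (formal group; it is the displayed step "c₂(E)·|Ẽ^{ns}(𝔽₂)|·Q ∈ Ê(2𝒪_{K_2}) ⟹ |Ẽ^{ns}(𝔽₂)|·log_E Q ∈ 2𝒪_{K_2}" of the proof of Kriz–Li 2019 Lemma 4.1 (= FMS Lemma 5.4), for 2^m instead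 of 2; AEC IV.6.3); AN-31a′ KNOWN = Kriz–Li Lemma 4.1 contraposed, in exponent currency (Kriz–Li derive c_E odd from Abbes–Ullmo at good/multiplicative 2 and assume it at additive 2; here ord₂ c is a parameter); AN-31b, AN-31↓ in-print assembly; AN-31M KNOWN = the instance (p, m, E′, M, pNN′/M) = (2, 1, E^{(ℓ*)}, N², 2ℓ²) of Kriz–Li Thm 1.8 (= FMS Thm 1.16), an equation mod 2𝒪_{K_2} with unit Euler factors (Rem. 1.9), hence symmetric — the two-sided reading is not beyond print (K is Heegner for N and Nℓ²; only Thm 3.3 (= FMS 4.3) packages one direction); AN-31P in-print assembly: the proof of Kriz–Li Lemma 4.6 (= FMS 5.9) uses of its hypothesis "BSD(2) for E/K" only "c_ℓ(E) odd for ℓ ∣ N", which the slice supplies, together with Mazur–Rubin 2010 Lemma 2.10 (ii),(v) / Cor. 3.4 (ii); Λ = 1 ⟺ loc₂κ(R) ≠ 0 at a = 0 is formal-group folklore. AN-31 and AN-31c: NOT IN PRINT, not refuted in print, OPEN at p = 2 — the two directions of Kolyvagin-exactness at 2 on this slice: AN-31c is Gross 1991 Prop. 2.3 ("Let p be an odd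 prime such that ℚ(E_p) has Galois group GL₂(ℤ/p) …; then Sel(E/K)_p is cyclic, generated by δy_K") at p = 2, where print has only Kolyvagin's bound #Ш(E/K) ∣ t_{E/K}·I_K² with 2 ∣ t_{E/K} allowed (Gross 1991 Thm 1.3; McCallum 1991 and GJPST 2009 Thms 3.4/3.7: odd p; GJPST do p = 2 by explicit 2-descent, Thm 3.25); AN-31 is the rank-one consequence of Kolyvagin's conjecture, in print for p ≥ 5 (W. Zhang 2014 Thms 1.1–1.3) and p > 3 (Burungale–Castella–Grossi–Skinner 2023), never at 2; Kriz–Li take BSD(2)(E/K) as input exactly here (Thm 1.12 (= FMS 5.1), Lemmas 4.4, 4.6: "Assume BSD(2) is true for E/K"; §4.1 (= FMS §5.1): "not known in general how to show this directly"; FMS Rem. 1.14: "the p-converse … for p = 2 is not known"). Both are BSD₂(E/K)-implied through the Gross–Zagier index identity (Cor. 4.2 = FMS 5.5); the printed rank-one 2-part results are CM (Tian 2014, Coates–Li–Tian–Zhai 2015, Cai–Li–Zhai 2016; Li–Tian–Yan–Zhu 2025), outside this slice; in the tree, the any-p Kolyvagin descent `HeegnerPointsKolyvaginVisibleDescent*`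 (gk2 lineage) is the machine AN-31c would instantiate at 2 once its displayed inputs are discharged, and the fkl-p1 lineage's U₀⁻ (report G10 §3) is the M = 2, minimal-door, Δ < 0 corner of the same forward direction. Grade of the typed layer: NEW-COMBINATION (levers Kriz–Li Lemma 4.1 / Thm 1.8 / Lemma 4.6 and Mazur–Rubin silence each already used on this problem by Kriz–Li §4; the delta is the split (★) = [m = 0] ∧ [β = 1], the orbit-closed residual locus {σ = 1} ∩ ({a ≥ 1} ∪ {a = 0, β = 0}) and its census); beyond-print theorem: no; PARTITION none; BSD not proved.» [cite: KrizLi2019, Lemma 4.1, Cor. 4.2, Lemma 4.4, Cor. 4.5, Lemma 4.6, Thm. 1.8, Rem. 1.9, Thm. 3.3, Thm. 1.12, §4.1 (arXiv:1606.03172) = FMS Lemma 5.4, Cor. 5.5, Lemma 5.7, Cor. 5.8, Lemma 5.9, Thm. 1.16, Rem. 1.17, Thm. 4.3, Thm. 5.1, §5.1; FMS Rem. 1.14] [cite: MazurRubin2010, Lemma 2.10 (ii),(v), Cor. 3.4 (ii)] [cite: GrossLMS1991, Thm. 1.3, Prop. 2.1, Prop. 2.3] [cite: GrigorovJorzaPatrikisSteinTarnita2009,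 Thm. 3.4, Thm. 3.7, Thm. 3.25] [cite: Zhang2014CJM, Thm. 1.1, Thm. 1.3]
PARTITION: none (frontier tier; the L child of crux-23715's bottom layer); beyond-print theorem: no.  BSD is not proved by any of this.
[cite: KrizLi2019, Lemma 4.1 and Cor. 4.2, §4.1 (= FMS §5.1: «not known in general how to show this directly»), Rem. 1.14 (FMS only: p-converse at 2 not known)] [cite: GrossZagier1986, V.(2.2)] [cite: GrossLMS1991, Conj. 1.2, Prop. 2.1, Prop. 2.3 (p odd)] [cite: Zhang2014CJM, Thm. 1.1, Thm. 1.3 (p ≥ 5)] -/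
@[conjecture] def ExponentCapOfMinimalSelmerAtTwo : Prop :=
  ∀ (W : WeierstrassCurve ℚ) [W.IsElliptic] [W.IsGloballyMinimal] [NeZero (W.conductorNorm ℤ)],
    ¬ W.HasCM → (∀ n : ℕ, W.HasSurjectiveModNGaloisRep ((2 ^ n : ℕ) : ℤ)) → Odd W.torsionOrder → Odd W.tamagawaProduct →
    W.analyticRank = 1 →
    ∀ (K : Type) [Field K] [NumberField K], IsImaginaryQuadratic K →
      DoorAdmissible W (NumberField.discr K) →
      ∀ (Dt : ModularParametrizationData W (W.conductorNorm ℤ))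
        (H : HeegnerDatum (W.conductorNorm ℤ) (NumberField.discr K)) (ι : K →+* ℂ)
        (P : (W.baseChange K).toAffine.Point),
        WeierstrassCurve.Affine.Point.map ι.toRatAlgHom P = heegnerPointComplex Dt H →
        Nat.card ((W.baseChange K).selmerGroup 2) = 2 →
        ∀ m : ℕ, HasTwoDivisibilityUpToTorsion W K P m → m ≤ padicValInt 2 Dt.c

/-- **AN-31↓ `LowerHalfOnMinimalSelmerLocusAtTwo`: the tree's `DoorIndexLawLowerCAtTwo` RESTRICTED to `#Sel₂(E/K) = 2`** (binders
verbatim plus the Selmer hypothesis after the Heegner-point binder).  PROVED below from AN-31. -/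
def LowerHalfOnMinimalSelmerLocusAtTwo : Prop :=
  ∀ (W : WeierstrassCurve ℚ) [W.IsElliptic] [W.IsGloballyMinimal] [NeZero (W.conductorNorm ℤ)],
    ¬ W.HasCM → (∀ n : ℕ, W.HasSurjectiveModNGaloisRep ((2 ^ n : ℕ) : ℤ)) → Odd W.torsionOrder → Odd W.tamagawaProduct →
    W.analyticRank = 1 →
    ∀ (K : Type) [Field K] [NumberField K], IsImaginaryQuadratic K →
      DoorAdmissible W (NumberField.discr K) →
      (W.quadraticTwist (NumberField.discr K : ℚ)).entireLFunction 1 ≠ 0 →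
      ∀ (Dt : ModularParametrizationData W (W.conductorNorm ℤ))
        (H : HeegnerDatum (W.conductorNorm ℤ) (NumberField.discr K)) (ι : K →+* ℂ)
        (P : (W.baseChange K).toAffine.Point),
        WeierstrassCurve.Affine.Point.map ι.toRatAlgHom P = heegnerPointComplex Dt H →
        Nat.card ((W.baseChange K).selmerGroup 2) = 2 →
        ∀ (Wd : WeierstrassCurve ℚ) [Wd.IsElliptic] [Wd.IsGloballyMinimal] (Cd : WeierstrassCurve.VariableChange ℚ),
          Cd • W.quadraticTwist (NumberField.discr K : ℚ) = Wd →
          ∀ m : ℕ, HasTwoDivisibilityUpToTorsion W K P m →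
            2 * m + (if W.Δ < 0 then 1 else 0) ≤
              padicValNat 2 (Nat.card (AddCommGroup.primaryComponent W.sha 2)) +
                padicValNat 2 (Nat.card (AddCommGroup.primaryComponent Wd.sha 2)) +
                transpCount W (NumberField.discr K) + 2 * identCount W (NumberField.discr K) + 2 * padicValInt 2 Dt.c

/-- **Glue (PROVED): AN-31 ⟹ AN-31↓.** -/
theorem lowerOnMinSel_of_cap (h : ExponentCapOfMinimalSelmerAtTwo) : LowerHalfOnMinimalSelmerLocusAtTwo := by
  intro W _ _ _ hcm hsurj htor htam hr K _ _ hK hadm _hL1 Dt H ι P hP hsel Wd _ _ Cd _hCd m hm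
  have hcap : m ≤ padicValInt 2 Dt.c := h W hcm hsurj htor htam hr K hK hadm Dt H ι P hP hsel m hm
  have ht := signIndicator_le_transpCount W hadm
  omega

/-- **AN-31c `MinimalSelmerOfOddIndexAtTwo` (CONJECTURE; the bottom layer of `UPPER` in Selmer currency = Kolyvagin's first layer
at `p = 2`).**  On the slice, at a door: if the datum has odd constant and the Heegner point is NOT divisible by `2` modulo torsion
(`m = 0`) then `#Sel₂(E/K) = 2` (equivalently `rank E(K) = 1 ∧ Ш(E/K)[2] = 0`).  Kriz–Li 2019 Cor. 4.2 + §4.1: on the `(★)` locus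
this is what `BSD₂(E/K)` amounts to and "it is not known in general how to show this directly"; they obtain it only for the twists
`E^{(d)}`, `d ∈ 𝒩`, by transporting it from a VERIFIED base curve (Lemma 4.4, Mazur–Rubin silence).  Why it might fail: it is the
`2`-primary Kolyvagin bound with no loss (`Gal(K(E[2])/K) ≅ S₃` has no complex-conjugation-type element acting as a transvection …);
Gross's exposition of Kolyvagin excludes `p = 2`.  Census ENGINE S P31.2 (`m = 0 ⟹ ellrank(E) = [1,1,0] ∧ ellrank(E^d) = [0,0,0]`, the
ℚ-proxy for `σ(E/K) = 1` at the minimal door, REF1 §107 r3): 1 239/1 239.  REF1 §107: SURVIVES as typed, conjecture-grade (the UPPER half of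
BSD₂(E/K) at the bottom layer via Gross's index identity; open at `2` in print), CLEARED.
[cite: KrizLi2019, Cor. 4.2, Lemma 4.4 (index transport), Cor. 4.5, Lemma 4.6 (Selmer transport = the «Mazur–Rubin silence» above)] [cite: GrossLMS1991, Thm. 1.3 (2 ∣ t_{E/K} allowed), Prop. 2.1/2.3 (p odd)] -/
@[conjecture] def MinimalSelmerOfOddIndexAtTwo : Prop :=
  ∀ (W : WeierstrassCurve ℚ) [W.IsElliptic] [W.IsGloballyMinimal] [NeZero (W.conductorNorm ℤ)],
    ¬ W.HasCM → (∀ n : ℕ, W.HasSurjectiveModNGaloisRep ((2 ^ n : ℕ) : ℤ)) → Odd W.torsionOrder → Odd W.tamagawaProduct →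
    W.analyticRank = 1 →
    ∀ (K : Type) [Field K] [NumberField K], IsImaginaryQuadratic K →
      DoorAdmissible W (NumberField.discr K) →
      ∀ (Dt : ModularParametrizationData W (W.conductorNorm ℤ))
        (H : HeegnerDatum (W.conductorNorm ℤ) (NumberField.discr K)) (ι : K →+* ℂ)
        (P : (W.baseChange K).toAffine.Point),
        WeierstrassCurve.Affine.Point.map ι.toRatAlgHom P = heegnerPointComplex Dt H →
        ¬ (2 : ℤ) ∣ Dt.c → HasTwoDivisibilityUpToTorsion W K P 0 →
        Nat.card ((W.baseChange K).selmerGroup 2) = 2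

/-! ### §4 AN-31M — rigidity of the bottom bit along Kriz–Li's silent twist orbit (THEOREM-CANDIDATE) -/

/-- `P ∈ E(K)` is **`2`-adically primitive at `j`**: `ord₂ L(W, j, P) = m + 1` for its exponent(s) `m`, i.e. the generator of
`E(K) ⊗ ℤ₂` modulo which `P = 2^m ·(unit)·R` is not divisible by `2` in `E(ℚ₂)` ("`β = 1`", ENGINE S columns `Lam`, `beta`). -/
def TwoAdicallyPrimitiveAt (W : WeierstrassCurve ℚ) [W.IsGloballyMinimal] (K : Type) [Field K] [NumberField K]
    (j : K →ₐ[ℚ] ℚ_[2]) (P : (W.baseChange K).toAffine.Point) : Prop :=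
  ∀ m : ℕ, HasTwoDivisibilityUpToTorsion W K P m → ‖normLogAtTwo W K j P‖ = (2 : ℝ) ^ (-((m : ℤ) + 1))

/-- Kriz–Li's signed silent prime: `ℓ* = ℓ` if `ℓ ≡ 1 (4)`, else `−ℓ` (so `ℓ* ≡ 1 (4)` for odd `ℓ`). -/
def signedPrime (ℓ : ℕ) : ℤ := if ℓ % 4 = 1 then (ℓ : ℤ) else -(ℓ : ℤ)

/-- **AN-31M `SilentTwistStarRigidityAtTwo` (THEOREM-CANDIDATE = Kriz–Li 2019 Thm. 1.16 ⇒ Thm. 3.3 first bullet, read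
two-sidedly).**  Kriz–Li's congruence `n₂·log_{ω_E}(P)/2 ≡ n₂'·log_{ω_{E'}}(P')/2 (mod 2)` for `E' = E^{(ℓ*)}`, `ℓ` a silent prime
(`ℓ ∤ 2N`, split in `K`, `a_ℓ(E)` odd, so `E[2] ≅ E'[2]` with `Frob_ℓ` of order `3`), makes the tree's `(★)`-bit `AssumptionStar`
(`‖log_Ê(c₂n₂P)/(c₂·c)‖ = 1/2`, i.e. `ord₂(n₂ log_{ω_E} P) = 1` — `log_{ω_E} = log_Ê / c` for a datum of constant `c`) an INVARIANT
of the silent orbit over a fixed door `K`.  Printed direction: `(★)` for `E` ⟹ `(★)` for `E^{(d)}`, `d ∈ 𝒩` (Thm. 3.3); the converse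
is the same congruence (Thm. 1.16 is symmetric in `E, E'`; flagged because `ℓ ∣ N'`, so Thm. 3.3 as printed does not apply backwards).
Hypotheses kept verbatim from the slice (they give `E(ℚ)[2] = 0`, `c₂` odd); odd constants make both sides `2`-integral.
Role: with `ord₂(normLog) = m + Λ` (exponent `m` of `P`, `Λ = ord₂ log_Ê(c₂n₂R)` for the generator `R` of `E(K) ⊗ ℤ₂ = E(ℚ) ⊗ ℤ₂`),
the invariant bit is `[m = 0 ∧ Λ = 1]`; so on the `σ = 1` locus the bottom layer of `LOWER` (AN-31) for `W` and `W'` forces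
AN-31P below.  REF1 §107: SURVIVES as a theorem-candidate (KL Thm 1.8 read mod `2𝒪_{K_2}`, the `±` sign immaterial mod 2 — REF2 placement note
r5); silent-prime binders = `KrizLi2019.InS W K ℓ` unfolded (`Iff.rfl`, REF1 e2); `signedPrime ℓ ≡ 1 (4)` (e-lemma).
[cite: KrizLi2019, Thm. 1.8 (= FMS Thm. 1.16), Rem. 1.9 (Euler factors), Thm. 2.9 (§2.6, general congruence), Thm. 3.3, §3.2] -/
def SilentTwistStarRigidityAtTwo : Prop :=
  ∀ (W : WeierstrassCurve ℚ) [W.IsElliptic] [W.IsGloballyMinimal] [NeZero (W.conductorNorm ℤ)],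
    ¬ W.HasCM → (∀ n : ℕ, W.HasSurjectiveModNGaloisRep ((2 ^ n : ℕ) : ℤ)) → Odd W.torsionOrder → Odd W.tamagawaProduct →
    W.analyticRank = 1 →
    ∀ (K : Type) [Field K] [NumberField K], IsImaginaryQuadratic K →
      DoorAdmissible W (NumberField.discr K) →
      ∀ (Dt : ModularParametrizationData W (W.conductorNorm ℤ))
        (H : HeegnerDatum (W.conductorNorm ℤ) (NumberField.discr K)) (ι : K →+* ℂ)
        (P : (W.baseChange K).toAffine.Point) (j : K →ₐ[ℚ] ℚ_[2]),
        WeierstrassCurve.Affine.Point.map ι.toRatAlgHom P = heegnerPointComplex Dt H →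
        ¬ (2 : ℤ) ∣ Dt.c →
        ∀ (ℓ : ℕ), ℓ.Prime → ¬ (ℓ ∣ 2 * W.conductorNorm ℤ) →
          ((Ideal.span {(ℓ : ℤ)}).primesOver (NumberField.RingOfIntegers K)).ncard = 2 →
          Odd (W.frobeniusTrace ℓ) →
          ∀ (W' : WeierstrassCurve ℚ) [W'.IsElliptic] [W'.IsGloballyMinimal] [NeZero (W'.conductorNorm ℤ)]
            (C' : WeierstrassCurve.VariableChange ℚ),
            C' • W.quadraticTwist (signedPrime ℓ : ℚ) = W' →
            ∀ (Dt' : ModularParametrizationData W' (W'.conductorNorm ℤ))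
              (H' : HeegnerDatum (W'.conductorNorm ℤ) (NumberField.discr K))
              (P' : (W'.baseChange K).toAffine.Point),
              WeierstrassCurve.Affine.Point.map ι.toRatAlgHom P' = heegnerPointComplex Dt' H' →
              ¬ (2 : ℤ) ∣ Dt'.c →
              (AssumptionStar W Dt K P j ↔ AssumptionStar W' Dt' K P' j)

/-- **AN-31P `PrimitivityPropagatesAtTwo` (THEOREM-CANDIDATE; elementary given Kriz–Li L4.6 = the Mazur–Rubin local lemma, and
`BSD₂(E/K)`-implied independently; `L`-free AND Heegner-point-free).**  On the slice, at a door `K` with `#Sel₂(E/K) = 2` (`σ = 1`) and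
`E(ℚ₂)[2] = 0` (`a = 0`): if the generator of `E(K) ⊗ ℤ₂` is `2`-adically primitive (`Λ = 1`, stated as `TwoAdicallyPrimitiveAt` for
every `K`-point), then for every silent prime `ℓ` (`ℓ ∤ 2N`, split in `K`, `a_ℓ` odd) and every globally minimal model `W'` of `W^{(ℓ*)}`,
the generator of `E'(K) ⊗ ℤ₂` is `2`-adically primitive too.
PROOF SKETCH (why theorem-candidate): for `a = 0` one has `E(ℚ₂) ⊗ ℤ₂ ≅ ℤ₂` (`E⁰ ⊗ ℤ₂` torsion-free with `E₁ = 2(E⁰ ⊗ ℤ₂)` in the additive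
case, `E₁ = E ⊗ ℤ₂` in the good supersingular case; multiplicative reduction forces `a ≥ 1`), `c₂n₂·(generator)` sits at formal-group
level exactly `1`, and `log_Ê(Ê(2ℤ₂)) = 2ℤ₂`; hence `Λ = 1 ⟺ R ∉ 2E(ℚ₂) ⟺ loc₂ κ(R) ≠ 0`, the LOCAL BIT AT `2` OF THE SELMER LINE
`Sel₂(E/K) = 𝔽₂·κ(R)`.  Kriz–Li L4.6 (places `v ∣ ℓ`: `H¹(K_v, E[2]) = 0` by silence; `v ∣ qN`, `v ∣ 2` with `ℓ* ≢ 1 (8)`: unramified twist,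
`c_q` odd + Lang; no real places) gives `Sel₂(E'/K) = Sel₂(E/K)` as the SAME line in `H¹(K, E[2]) = H¹(K, E'[2])`, so `κ'(R') = κ(R)` and
`loc₂` agrees: `Λ' = 1 ⟺ Λ = 1` (and `a' = a = 0` since the `2`-division cubic only rescales).  ENGINE S measured `Λ = 1` on `465/591`
`a = 0` slice curves (good supersingular `211/310`, additive `254/281`), so the statement has content; ENGINE T (P31.8) checks it pair by pair.
WHY ALSO BSD-IMPLIED (the reason it was found): `ord₂(normLog of the Heegner point) = m + Λ`, so AN-31(W) (`σ = 1 ⟹ m = 0`) makes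
`(★)(W) ⟺ Λ = 1`, and AN-31M transports `(★)`.  ROLE: with AN-31M it makes the bottom bit of the Heegner index RIGOROUSLY orbit-constant on
`{σ = 1, a = 0, Λ = 1}` (Kriz–Li's reach, one verified member per orbit), and it shows that the complementary locus `{σ = 1, a = 0, Λ ≥ 2}`
(`126/591` curves; `92` clean census rows) is closed under silent twisting and invisible to `(★)` on every member — the exact frontier of
`stub_doorLowerC` at the bottom layer inside `a = 0`.  Why it might fail: only through the level analysis at additive places of type where
`E⁰(ℚ₂) ⊗ ℤ₂` is not pro-cyclic (excluded by `a = 0`) — ENGINE S's 4 rows with `β_direct = 1, Λ ≥ 2` (all Kodaira IV*, `c₂ = 3`) are Sage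
`2`-adic halving artefacts (`Λ` is exact arithmetic) — CONFIRMED by ENGINE B (kit j308331, PARI `polrootspadic` halving test): `β = 0` on all 4,
`a = 0 ⟹ (β = 1 ⟺ Λ = 1)` on `591/591` slice curves, and the `β`-bit is silent-orbit-constant on `1747/1747` pairs of ENGINE T (every `a`).  TYPER NOTE (REF1 §107 r9, the ONLY statement deviation from Sketch_v22 in this file, RECOMMENDED by REF1 before filing): the binder
`(∃ R, R ∉ E(K)_tors) →` after the Selmer binder closes the rank-`0` / infinite-`Ш` corner in which the hypothesis `TwoAdicallyPrimitiveAt` is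
vacuous (torsion points have no exact exponent, REF1 e-lemma) while the conclusion is not; the sketch's row (without the binder) implies this
one (REF1 e7) and was «theorem-candidate at doors with `rank E(K) = 1`, BSD-implied in the infinite-Ш corner»; with the binder the row is an
L-free, Heegner-free THEOREM-CANDIDATE outright (KL Lemma 4.6's Selmer-line identity + the `a = 0` pro-cyclicity of `E(ℚ₂) ⊗ ℤ₂`).
REF1 §107: SURVIVES; mutation check: `a = 0` is load-bearing for content only (`a ≥ 1 ⟹ Λ ≥ 2` on 1 121/1 121 curves, 1 119/1 119 twists);
BC7 recount P31.8 567/567 + 47/47 extra-room doors, β-bit orbit-constant 1 745/1 745 (ENGINE T's «0 errors» excludes 491 `ψ = −1` pairs skipped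
by design, r8).  [cite: KrizLi2019, Lemma 4.6, Thm. 3.3] [cite: MazurRubin2010, Lemma 2.10 (ii), (v) and Cor. 3.4 (ii)] -/
def PrimitivityPropagatesAtTwo : Prop :=
  ∀ (W : WeierstrassCurve ℚ) [W.IsElliptic] [W.IsGloballyMinimal] [NeZero (W.conductorNorm ℤ)],
    ¬ W.HasCM → (∀ n : ℕ, W.HasSurjectiveModNGaloisRep ((2 ^ n : ℕ) : ℤ)) → Odd W.torsionOrder → Odd W.tamagawaProduct →
    W.analyticRank = 1 →
    ∀ (K : Type) [Field K] [NumberField K], IsImaginaryQuadratic K →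
      DoorAdmissible W (NumberField.discr K) →
      Nat.card ((W.baseChange K).selmerGroup 2) = 2 →
      (∃ R : (W.baseChange K).toAffine.Point, R ∉ AddCommGroup.torsion (W.baseChange K).toAffine.Point) →
      (haveI : Fact (Nat.Prime 2) := ⟨Nat.prime_two⟩
        ∀ T : (W.baseChange ℚ_[2]).toAffine.Point, (2 : ℕ) • T = 0 → T = 0) →
      ∀ (j : K →ₐ[ℚ] ℚ_[2]),
        (∀ P : (W.baseChange K).toAffine.Point, TwoAdicallyPrimitiveAt W K j P) →
        ∀ (ℓ : ℕ), ℓ.Prime → ¬ (ℓ ∣ 2 * W.conductorNorm ℤ) →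
          ((Ideal.span {(ℓ : ℤ)}).primesOver (NumberField.RingOfIntegers K)).ncard = 2 →
          Odd (W.frobeniusTrace ℓ) →
          ∀ (W' : WeierstrassCurve ℚ) [W'.IsElliptic] [W'.IsGloballyMinimal] (C' : WeierstrassCurve.VariableChange ℚ),
            C' • W.quadraticTwist (signedPrime ℓ : ℚ) = W' →
            ∀ P' : (W'.baseChange K).toAffine.Point, TwoAdicallyPrimitiveAt W' K j P'

/-- **AN-31M∘P (PROVED shape lemma): on an orbit where both Heegner points have exponent `0` iff `(★)` holds, `(★)`-rigidity transports
the bottom bit.**  Pure logic; records how AN-31M is used. -/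
theorem bottomBit_transport {S S' : Prop} {m m' : ℕ} (hrig : S ↔ S') (hW : S ↔ m = 0) (hW' : S' ↔ m' = 0) :
    (m = 0 ↔ m' = 0) := by
  constructor
  · intro h; exact hW'.mp (hrig.mp (hW.mpr h))
  · intro h; exact hW.mp (hrig.mpr (hW'.mpr h))

end Summit.BirchSwinnertonDyer.Rank1Residual.F1Sign2.BottomLayer

end
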